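import Literature.AnabelianGeometry.SemiGraphs.QuasiTemperoidsThmA4OfEngine
import Literature.AnabelianGeometry.SemiGraphs.QuasiTemperoidsThmA4CechExtension
import Literature.AnabelianGeometry.SemiGraphs.OverPrimeDownwardClosed
import Literature.AnabelianGeometry.SemiGraphs.BTempProdColimits
import HarnessLib

/-!
# Semi-graphs of anabelioids, Appendix, Theorem A.4: the named fact `ThmA4` REDUCED to the finite-limit
# clause of the Čech extension `ψ^* = coeq(φ^*(X × A₂ × A₂) ⇉ φ^*(X × A₂))`

Mochizuki, *Semi-graphs of anabelioids*, Publ. RIMS **42** (2006) 221–322, Appendix, Theorem A.4 and its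
proof, manuscript pp. 82–86 (PRIMS pp. 312–316) [cite: MochizukiSemiAnbd2006, Thm A.4 pp.82-86]:
"The fact that the resulting functor `ψ^* : T₂ → T₁` preserves countable colimits (respectively,
fibered products) follows by a routine argument from the fact that `φ^*` preserves countable colimits
(respectively, countable colimits and finite limits). Thus, to show that `ψ` is a morphism of temperoids
[i.e., that `ψ^*` preserves finite limits], it suffices to show that `ψ^*` preserves terminal objects."

Row **A4-∃** of the abc-iut cell's `plan/L3/SUBDAG-SemiAnbd-Cor311.md` (the coequaliser route to the
existence half of Thm. A.4; holder abc-iut-w5-d129, cut 2026-08-26T03:36Z / ruling α20; this file by seat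
abc-iut-w5-d220), ASSEMBLY OF THE ENGINE MODULO ITS FINITE-LIMIT CLAUSE.  With
`Ψ := ThmA4Cech.Ψ A₂ (φ^* ⋙ ι₁)` (abc-iut-L3-t5, `QuasiTemperoidsThmA4CechExtension.lean`: the Čech
extension of abc-iut-w4-d081's `ThmA4CechPresentation.lean`) for the model quasi-temperoids
`B^temp(Πᵢ)[Aᵢ] ⊆ B^temp(Πᵢ)`:

* the COUNTABLE-COLIMIT clause of the engine holds —
  `ThmA4Cech.preservesColimitsOfShape_Ψ_bTemp` (t5's `preservesColimitsOfShape_Ψ` fed with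
  "`X ↦ X × A₂` preserves countable colimits in `B^temp(Π₂)`", `BTempProdColimits.lean`, and
  "`T₁[A₁] ⊆ B^temp(Π₁)` preserves countable colimits", `OverPrimeDownwardClosed.lean`);
* the 1-COMMUTATION clause holds — `ThmA4Cech.nonempty_α_bTemp` (t5's `α`, unconditional);
* hence **`ThmA4Cech.engine_of_cechFiniteLimits`**: the engine binder `hE` of abc-iut-w5-d129's
  `ThmA4Chart.thmA4_of_engine'` (`QuasiTemperoidsThmA4OfEngine.lean`) FOLLOWS from the single remaining
  clause "`Ψ` preserves finite limits" (row A4-∃ file E3), and **`ThmA4Cech.thmA4_of_cechFiniteLimits`**: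
  the named fact `ThmA4` (FACT-LIST F-1634) follows from that clause alone.

CONDITIONAL on the finite-limit clause (stated as the hypothesis `hlim`, quantified exactly like `hE`);
nothing is rounded up; proof-only.  Nothing refers to the IUT corpus and no side is taken on any disputed
claim.
-/

namespace Literature.AnabelianGeometry.SemiGraphs

namespace ThmA4Cech

open CategoryTheory CategoryTheory.Limits
open Literature.AlgebraicGeometry.Frobenioids (IsConnectedObj)

universe v₁ v₂ u u₁ u₂

section Clauses

variable {G₁ : Type u} [Group G₁] [TopologicalSpace G₁] [IsTopologicalGroup G₁]
  {G₂ : Type u} [Group G₂] [TopologicalSpace G₂] [IsTopologicalGroup G₂]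
  [HasBinaryProducts (BTemp G₂)] [HasColimitsOfShape WalkingParallelPair (BTemp G₁)]
  {A₁ : BTemp G₁} (A₂ : BTemp G₂) (F : Over' A₂ ⥤ Over' A₁)

/-- **The countable-colimit clause of the engine**: the Čech extension
`Ψ = coeq(F(X × A₂ × A₂) ⇉ F(X × A₂))` of `F ⋙ ι₁` preserves colimits of every countable shape as soon as
`F` does ("follows by a routine argument from the fact that `φ^*` preserves countable colimits":
`X ↦ X × A₂` and `T₁[A₁] ⊆ B^temp(Π₁)` preserve them). [cite: MochizukiSemiAnbd2006, Thm A.4 proof p.85] -/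
theorem preservesColimitsOfShape_Ψ_bTemp (J : Type) [SmallCategory J] [Countable J]
    [PreservesColimitsOfShape J F] :
    PreservesColimitsOfShape J (Ψ A₂ (F ⋙ (admitsHomTo A₁).ι)) := by
  haveI : HasColimitsOfShape J (BTemp G₁) := BTemp.hasColimitsOfShape_of_countable J
  haveI := BTemp.preservesColimitsOfShape_prodFunctor_flip_obj (G := G₂) A₂ J
  haveI : PreservesColimitsOfShape J (admitsHomTo A₁).ι := overPrime_ι_preservesColimitsOfShape A₁ J
  exact preservesColimitsOfShape_Ψ A₂ (F ⋙ (admitsHomTo A₁).ι) J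

/-- The same clause for Mathlib's `CountableCategory` shapes (the form of the engine binder).
[cite: MochizukiSemiAnbd2006, Thm A.4 proof p.85] -/
theorem preservesColimitsOfShape_Ψ_bTemp_of_countableCategory (J : Type)
    [SmallCategory J] [CountableCategory J] [PreservesColimitsOfShape J F] :
    PreservesColimitsOfShape J (Ψ A₂ (F ⋙ (admitsHomTo A₁).ι)) :=
  preservesColimitsOfShape_Ψ_bTemp A₂ F J

omit [IsTopologicalGroup G₁] [IsTopologicalGroup G₂] in
/-- **The 1-commutation clause of the engine**: `F ⋙ ι₁ ≅ ι₂ ⋙ Ψ` (t5's `ThmA4Cech.α`, unconditional —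
the presenting coequalisers are split). [cite: MochizukiSemiAnbd2006, Thm A.4 pp.82-86] -/
theorem nonempty_α_bTemp :
    Nonempty (F ⋙ (admitsHomTo A₁).ι ≅ (admitsHomTo A₂).ι ⋙ Ψ A₂ (F ⋙ (admitsHomTo A₁).ι)) :=
  ⟨α A₂ (F ⋙ (admitsHomTo A₁).ι)⟩

end Clauses

/-- **The engine of `ThmA4Chart.thmA4_of_engine'` from its finite-limit clause alone.**  If, for all
tempered `Πᵢ`, connected `Aᵢ ∈ B^temp(Πᵢ)` and every `F : B^temp(Π₂)[A₂] ⥤ B^temp(Π₁)[A₁]` preserving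
finite limits, countable colimits and nondegenerate objects, the Čech extension `Ψ A₂ (F ⋙ ι₁)` preserves
finite limits (row A4-∃, file E3), then `Ψ` is the required extension: it preserves countable colimits
(`preservesColimitsOfShape_Ψ_bTemp`) and `F ⋙ ι₁ ≅ ι₂ ⋙ Ψ` (`α`). CONDITIONAL on `hlim`.
[cite: MochizukiSemiAnbd2006, Thm A.4 pp.82-86] -/
theorem engine_of_cechFiniteLimits
    (hlim : ∀ {G₁ : Type u} [Group G₁] [TopologicalSpace G₁] [IsTopologicalGroup G₁]
      {G₂ : Type u} [Group G₂] [TopologicalSpace G₂] [IsTopologicalGroup G₂]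
      [HasBinaryProducts (BTemp G₂)] [HasColimitsOfShape WalkingParallelPair (BTemp G₁)]
      (_ : IsTempered G₁) (_ : IsTempered G₂)
      {A₁ : BTemp G₁} (_ : IsConnectedObj A₁) {A₂ : BTemp G₂} (_ : IsConnectedObj A₂)
      (F : Over' A₂ ⥤ Over' A₁) (_ : PreservesFiniteLimits F)
      (_ : ∀ (J : Type) [SmallCategory J] [CountableCategory J], PreservesColimitsOfShape J F)
      (_ : ∀ X : Over' A₂, IsNondegenerateObj X → IsNondegenerateObj (F.obj X)),
      PreservesFiniteLimits (Ψ A₂ (F ⋙ (admitsHomTo A₁).ι))) :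
    ∀ {G₁ : Type u} [Group G₁] [TopologicalSpace G₁] [IsTopologicalGroup G₁]
      {G₂ : Type u} [Group G₂] [TopologicalSpace G₂] [IsTopologicalGroup G₂]
      (_ : IsTempered G₁) (_ : IsTempered G₂)
      {A₁ : BTemp G₁} (_ : IsConnectedObj A₁) {A₂ : BTemp G₂} (_ : IsConnectedObj A₂)
      (F : Over' A₂ ⥤ Over' A₁) (_ : PreservesFiniteLimits F)
      (_ : ∀ (J : Type) [SmallCategory J] [CountableCategory J], PreservesColimitsOfShape J F)
      (_ : ∀ X : Over' A₂, IsNondegenerateObj X → IsNondegenerateObj (F.obj X)),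
      ∃ Ψ : BTemp G₂ ⥤ BTemp G₁, PreservesFiniteLimits Ψ ∧
        (∀ (J : Type) [SmallCategory J] [CountableCategory J], PreservesColimitsOfShape J Ψ) ∧
        Nonempty (F ⋙ (admitsHomTo A₁).ι ≅ (admitsHomTo A₂).ι ⋙ Ψ) := by
  intro G₁ _ _ _ G₂ _ _ _ hG₁ hG₂ A₁ hA₁ A₂ hA₂ F hFlim hFcolim hFnd
  haveI : HasBinaryProducts (BTemp G₂) := by
    haveI := BTemp.hasFiniteLimits (G := G₂)
    infer_instance
  haveI : HasColimitsOfShape WalkingParallelPair (BTemp G₁) :=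
    BTemp.hasColimitsOfShape_of_countable WalkingParallelPair
  refine ⟨Ψ A₂ (F ⋙ (admitsHomTo A₁).ι), hlim hG₁ hG₂ hA₁ hA₂ F hFlim hFcolim hFnd, ?_,
    nonempty_α_bTemp A₂ F⟩
  intro J _ _
  haveI := hFcolim J
  exact preservesColimitsOfShape_Ψ_bTemp_of_countableCategory A₂ F J

/-- **Theorem A.4 (the named fact `ThmA4`, FACT-LIST F-1634) REDUCED TO THE FINITE-LIMIT CLAUSE of the
Čech extension**: if `Ψ A₂ (F ⋙ ι₁)` preserves finite limits for all model data as in the engine binder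
(row A4-∃, file E3: terminal object + fibre products at the level of points of `B^temp(Π₁)`), then
`ThmA4` holds — by abc-iut-w5-d129's `ThmA4Chart.thmA4_of_engine'` (charts + the uniqueness half
`thmA4_unique`). CONDITIONAL on `hlim`; nothing is rounded up.
[cite: MochizukiSemiAnbd2006, Thm A.4 pp.82-86] -/
theorem thmA4_of_cechFiniteLimits
    (hlim : ∀ {G₁ : Type u} [Group G₁] [TopologicalSpace G₁] [IsTopologicalGroup G₁]
      {G₂ : Type u} [Group G₂] [TopologicalSpace G₂] [IsTopologicalGroup G₂]
      [HasBinaryProducts (BTemp G₂)] [HasColimitsOfShape WalkingParallelPair (BTemp G₁)]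
      (_ : IsTempered G₁) (_ : IsTempered G₂)
      {A₁ : BTemp G₁} (_ : IsConnectedObj A₁) {A₂ : BTemp G₂} (_ : IsConnectedObj A₂)
      (F : Over' A₂ ⥤ Over' A₁) (_ : PreservesFiniteLimits F)
      (_ : ∀ (J : Type) [SmallCategory J] [CountableCategory J], PreservesColimitsOfShape J F)
      (_ : ∀ X : Over' A₂, IsNondegenerateObj X → IsNondegenerateObj (F.obj X)),
      PreservesFiniteLimits (Ψ A₂ (F ⋙ (admitsHomTo A₁).ι))) :
    Literature.AnabelianGeometry.SemiGraphs.ThmA4.{v₁, v₂, u, u₁, u₂} :=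
  ThmA4Chart.thmA4_of_engine' (fun hG₁ hG₂ _ hA₁ _ hA₂ F hFlim hFcolim hFnd =>
    engine_of_cechFiniteLimits hlim hG₁ hG₂ hA₁ hA₂ F hFlim hFcolim hFnd)

end ThmA4Cech

end Literature.AnabelianGeometry.SemiGraphs
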